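import Summits.ValiantsHypothesis.ValiantsHypothesis.Theorems.KPlusLogSqLawTropicalBMatchingTies

/-!
# Route «KPlusLogSqLaw», crux `TropicalB` (stmt-ValiantsHypothesis-19771) — TIE-TOLERANT MONOTONICITY: DELETING VERTICES NEVER RAISES
# THE OPTIMAL COUNT (no uniqueness assumed)

HONEST FRAMING.  Helper toward the registered stubs `stub_tropThin` / `stub_tropFat` of `Cruxes/TropicalB/Lines/birth.lean`
(crux `Summit.ValiantsHypothesis.ValiantsHypothesis.Theses.KPlusLogSqLaw.TropicalB`, item stmt-ValiantsHypothesis-19771, route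
KPlusLogSqLaw; cell `pub-symmetroid`, seat val-sym-trop-p1 g8, 2026-08-27; `--supports … --as helper`).  A COMBINATORIAL ENGINE;
nothing here bounds `TropicalB` or bears on `WeakLifting`, DoorA26 / DoorA34, `MatrixDescartes` (stmt-ValiantsHypothesis-18050) or
VP ≠ VNP.

THE POINT.  Companion of …TropicalBMatchingTies (which says: un-deleting `s` vertices raises the optimal count by at most `s`).  Here the
other direction of the interlacing law in tie-tolerant optimiser form: if `M'` is ANY minimum-weight matching inside `G`, then SOME
minimum-weight matching inside `G` minus a row / a column / a set of rows / a set of columns has AT MOST `|M'|` edges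
(`exists_isMin_card_le_del_row/col/rows/cols`).  In the separated-levels analysis for `K ≥ 4` classes (memo SEPARATED-LEVELS-g8.md §2)
a lower level's allowed vertex set both loses and GAINS vertices between consecutive chain slopes; gains never force the level's count
down, losses cost at most one edge each (…Ties), so `c_l(k) ≤ c_l(k+1) + #lost` for ANY choices of tied minimisers.
[folklore: M♮-concavity of the assignment valuation]
-/

set_option linter.dupNamespace false
set_option autoImplicit false

namespace Summit.ValiantsHypothesis.ValiantsHypothesis.Theorems.KPlusLogSqLaw

namespace MatchingExchange

open Finset
open scoped BigOperators
open Literature.Computability.MetaComplexity.PBij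

variable {α β : Type*} [DecidableEq α] [DecidableEq β]

/-- **Deleting one ROW never raises the optimal count (tie-tolerant).**  If `M'` is a minimum-weight matching inside `G` and `M₀` a
minimum-weight matching inside `G` minus row `v`, then some minimum-weight matching inside `G` minus row `v` has at most `|M'|` edges.
[folklore] -/
theorem exists_isMin_card_le_del_row {G : Finset (α × β)} {v : α} {w : α × β → ℤ} :
    ∀ (j : ℕ) (M' M₀ : Finset (α × β)), M₀.card = j →
      IsPMatching M' → M' ⊆ G →
      (∀ X : Finset (α × β), IsPMatching X → X ⊆ G → ∑ e ∈ M', w e ≤ ∑ e ∈ X, w e) →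
      IsPMatching M₀ → M₀ ⊆ G.filter (fun e => e.1 ≠ v) →
      (∀ X : Finset (α × β), IsPMatching X → X ⊆ G.filter (fun e => e.1 ≠ v) → ∑ e ∈ M₀, w e ≤ ∑ e ∈ X, w e) →
      ∃ M : Finset (α × β), IsPMatching M ∧ M ⊆ G.filter (fun e => e.1 ≠ v) ∧
        (∀ X : Finset (α × β), IsPMatching X → X ⊆ G.filter (fun e => e.1 ≠ v) → ∑ e ∈ M, w e ≤ ∑ e ∈ X, w e) ∧
        M.card ≤ M'.card := by
  intro j
  induction j using Nat.strong_induction_on with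
  | _ j ih =>
    intro M' M₀ hj hM' hM'G hmin' hM₀ hM₀G hmin₀
    by_cases hle : M₀.card ≤ M'.card
    · exact ⟨M₀, hM₀, hM₀G, hmin₀, hle⟩
    rw [not_le] at hle
    have hG₀ : M₀ ⊆ G := hM₀G.trans (Finset.filter_subset _ _)
    by_cases hv : v ∈ dom M'
    · obtain ⟨N₁, N₂, hN₁, hN₂, hU, hI, hc, hdom, -⟩ := exchange hM' hM₀ hle
      have hUG : M' ∪ M₀ ⊆ G := Finset.union_subset hM'G hG₀
      have hN₁G : N₁ ⊆ G := (subset_union_left hU).trans hUG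
      have hN₂G : N₂ ⊆ G := (subset_union_right hU).trans hUG
      have hsum := wt_add_eq hU hI w
      have hcN := card_add_eq hU hI hc
      have hvM₀ : v ∉ dom M₀ := by
        intro h'; obtain ⟨y, hy⟩ := mem_dom.1 h'
        exact (Finset.mem_filter.1 (hM₀G hy)).2 rfl
      have hvN₂ : v ∉ dom N₂ := row_exclusive hU hI hM' hvM₀ (hdom hv)
      have hN₂G' := subset_filter_row hN₂G hvN₂
      have h1 := hmin' N₁ hN₁ hN₁G
      have h2 := hmin₀ N₂ hN₂ hN₂G'
      -- `N₂` is a minimiser inside `G − v` with one edge fewer than `M₀`: descend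
      have hmin₂ : ∀ X : Finset (α × β), IsPMatching X → X ⊆ G.filter (fun e => e.1 ≠ v) →
          ∑ e ∈ N₂, w e ≤ ∑ e ∈ X, w e := by
        intro X hX hXG; have := hmin₀ X hX hXG; linarith
      exact ih N₂.card (by omega) M' N₂ rfl hM' hM'G hmin' hN₂ hN₂G' hmin₂
    · -- `M'` avoids row `v`: it is itself a minimiser inside `G − v`
      have hM'G' := subset_filter_row hM'G hv
      refine ⟨M', hM', hM'G', fun X hX hXG => ?_, le_rfl⟩
      exact hmin' X hX (hXG.trans (Finset.filter_subset _ _))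

/-- **Deleting one COLUMN never raises the optimal count (tie-tolerant).** [folklore] -/
theorem exists_isMin_card_le_del_col {G : Finset (α × β)} {v : β} {w : α × β → ℤ} :
    ∀ (j : ℕ) (M' M₀ : Finset (α × β)), M₀.card = j →
      IsPMatching M' → M' ⊆ G →
      (∀ X : Finset (α × β), IsPMatching X → X ⊆ G → ∑ e ∈ M', w e ≤ ∑ e ∈ X, w e) →
      IsPMatching M₀ → M₀ ⊆ G.filter (fun e => e.2 ≠ v) →
      (∀ X : Finset (α × β), IsPMatching X → X ⊆ G.filter (fun e => e.2 ≠ v) → ∑ e ∈ M₀, w e ≤ ∑ e ∈ X, w e) →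
      ∃ M : Finset (α × β), IsPMatching M ∧ M ⊆ G.filter (fun e => e.2 ≠ v) ∧
        (∀ X : Finset (α × β), IsPMatching X → X ⊆ G.filter (fun e => e.2 ≠ v) → ∑ e ∈ M, w e ≤ ∑ e ∈ X, w e) ∧
        M.card ≤ M'.card := by
  intro j
  induction j using Nat.strong_induction_on with
  | _ j ih =>
    intro M' M₀ hj hM' hM'G hmin' hM₀ hM₀G hmin₀
    by_cases hle : M₀.card ≤ M'.card
    · exact ⟨M₀, hM₀, hM₀G, hmin₀, hle⟩
    rw [not_le] at hle
    have hG₀ : M₀ ⊆ G := hM₀G.trans (Finset.filter_subset _ _)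
    by_cases hv : v ∈ rng M'
    · obtain ⟨N₁, N₂, hN₁, hN₂, hU, hI, hc, -, hrng⟩ := exchange hM' hM₀ hle
      have hUG : M' ∪ M₀ ⊆ G := Finset.union_subset hM'G hG₀
      have hN₁G : N₁ ⊆ G := (subset_union_left hU).trans hUG
      have hN₂G : N₂ ⊆ G := (subset_union_right hU).trans hUG
      have hsum := wt_add_eq hU hI w
      have hcN := card_add_eq hU hI hc
      have hvM₀ : v ∉ rng M₀ := by
        intro h'; obtain ⟨y, hy⟩ := mem_rng.1 h'
        exact (Finset.mem_filter.1 (hM₀G hy)).2 rfl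
      have hvN₂ : v ∉ rng N₂ := col_exclusive hU hI hM' hvM₀ (hrng hv)
      have hN₂G' := subset_filter_col hN₂G hvN₂
      have h1 := hmin' N₁ hN₁ hN₁G
      have h2 := hmin₀ N₂ hN₂ hN₂G'
      have hmin₂ : ∀ X : Finset (α × β), IsPMatching X → X ⊆ G.filter (fun e => e.2 ≠ v) →
          ∑ e ∈ N₂, w e ≤ ∑ e ∈ X, w e := by
        intro X hX hXG; have := hmin₀ X hX hXG; linarith
      exact ih N₂.card (by omega) M' N₂ rfl hM' hM'G hmin' hN₂ hN₂G' hmin₂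
    · have hM'G' := subset_filter_col hM'G hv
      refine ⟨M', hM', hM'G', fun X hX hXG => ?_, le_rfl⟩
      exact hmin' X hX (hXG.trans (Finset.filter_subset _ _))

/-- **Deleting a SET of ROWS never raises the optimal count (tie-tolerant).** [folklore] -/
theorem exists_isMin_card_le_del_rows {G : Finset (α × β)} {w : α × β → ℤ} :
    ∀ (D : Finset α) (M' : Finset (α × β)), IsPMatching M' → M' ⊆ G →
      (∀ X : Finset (α × β), IsPMatching X → X ⊆ G → ∑ e ∈ M', w e ≤ ∑ e ∈ X, w e) →
      ∃ M : Finset (α × β), IsPMatching M ∧ M ⊆ G.filter (fun e => e.1 ∉ D) ∧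
        (∀ X : Finset (α × β), IsPMatching X → X ⊆ G.filter (fun e => e.1 ∉ D) → ∑ e ∈ M, w e ≤ ∑ e ∈ X, w e) ∧
        M.card ≤ M'.card := by
  intro D
  induction D using Finset.induction_on with
  | empty =>
    intro M' hM' hM'G hmin'
    have hGG : G.filter (fun e : α × β => e.1 ∉ (∅ : Finset α)) = G := by ext e; simp
    rw [hGG]
    exact ⟨M', hM', hM'G, hmin', le_rfl⟩
  | insert a D ha ih =>
    intro M' hM' hM'G hmin'
    have hGG : G.filter (fun e : α × β => e.1 ∉ insert a D) = (G.filter (fun e : α × β => e.1 ∉ D)).filter (fun e => e.1 ≠ a) := by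
      ext e; simp only [Finset.mem_filter, Finset.mem_insert, not_or]; tauto
    obtain ⟨M₁, hM₁, hM₁G, hmin₁, hc₁⟩ := ih M' hM' hM'G hmin'
    obtain ⟨M₀, hM₀, hM₀G, hmin₀⟩ := exists_isMin ((G.filter (fun e : α × β => e.1 ∉ D)).filter (fun e => e.1 ≠ a)) w
    obtain ⟨M, hM, hMG, hmin, hc⟩ := exists_isMin_card_le_del_row _ M₁ M₀ rfl hM₁ hM₁G hmin₁ hM₀ hM₀G hmin₀
    rw [hGG]
    exact ⟨M, hM, hMG, hmin, hc.trans hc₁⟩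

/-- **Deleting a SET of COLUMNS never raises the optimal count (tie-tolerant).** [folklore] -/
theorem exists_isMin_card_le_del_cols {G : Finset (α × β)} {w : α × β → ℤ} :
    ∀ (D : Finset β) (M' : Finset (α × β)), IsPMatching M' → M' ⊆ G →
      (∀ X : Finset (α × β), IsPMatching X → X ⊆ G → ∑ e ∈ M', w e ≤ ∑ e ∈ X, w e) →
      ∃ M : Finset (α × β), IsPMatching M ∧ M ⊆ G.filter (fun e => e.2 ∉ D) ∧
        (∀ X : Finset (α × β), IsPMatching X → X ⊆ G.filter (fun e => e.2 ∉ D) → ∑ e ∈ M, w e ≤ ∑ e ∈ X, w e) ∧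
        M.card ≤ M'.card := by
  intro D
  induction D using Finset.induction_on with
  | empty =>
    intro M' hM' hM'G hmin'
    have hGG : G.filter (fun e : α × β => e.2 ∉ (∅ : Finset β)) = G := by ext e; simp
    rw [hGG]
    exact ⟨M', hM', hM'G, hmin', le_rfl⟩
  | insert a D ha ih =>
    intro M' hM' hM'G hmin'
    have hGG : G.filter (fun e : α × β => e.2 ∉ insert a D) = (G.filter (fun e : α × β => e.2 ∉ D)).filter (fun e => e.2 ≠ a) := by
      ext e; simp only [Finset.mem_filter, Finset.mem_insert, not_or]; tauto
    obtain ⟨M₁, hM₁, hM₁G, hmin₁, hc₁⟩ := ih M' hM' hM'G hmin'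
    obtain ⟨M₀, hM₀, hM₀G, hmin₀⟩ := exists_isMin ((G.filter (fun e : α × β => e.2 ∉ D)).filter (fun e => e.2 ≠ a)) w
    obtain ⟨M, hM, hMG, hmin, hc⟩ := exists_isMin_card_le_del_col _ M₁ M₀ rfl hM₁ hM₁G hmin₁ hM₀ hM₀G hmin₀
    rw [hGG]
    exact ⟨M, hM, hMG, hmin, hc.trans hc₁⟩

end MatchingExchange

end Summit.ValiantsHypothesis.ValiantsHypothesis.Theorems.KPlusLogSqLaw
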